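import Summits.ABC.ABC.Theses.DefiniteXi
import Summits.ABC.ABC.Theorems.DefiniteXiFreyModularity
import Summits.ABC.ABC.Theorems.DefiniteXiDefiniteRTControlPrime
import Summits.ABC.ABC.Theorems.DefiniteXiDefiniteRTControlPrimeSmulTransportDeg
import Summits.ABC.ABC.Theorems.DefiniteXiDefiniteRTControlPrimeValTransport
import Summits.ABC.ABC.Theorems.DefiniteXiDefiniteRTControlPrimeFreyScale
import Summits.ABC.ABC.Theorems.DefiniteXiDefiniteRTControlPrimeFreyLocal
import Literature.NumberTheory.EllipticCurves.TakahashiDegreeFormulaCoprimeProofs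
import Literature.NumberTheory.EllipticCurves.PastenSpectralDegree
import Literature.NumberTheory.EllipticCurves.PastenHeightBounds
import Literature.NumberTheory.EllipticCurves.PastenHeightBoundsLemma68LocalProofs
import Literature.NumberTheory.EllipticCurves.ModularCurveManinSemistableBridgeProofs
import Literature.NumberTheory.EllipticCurves.ModularDegreeMinimal
import Literature.NumberTheory.EllipticCurves.IsogenyVariableChangeProofs
import Literature.NumberTheory.EllipticCurves.IsogenyCompProofs
import Literature.NumberTheory.EllipticCurves.IsogenyDualProofs
import HarnessLib

/-!
# stub-ideation k3 · gen 7 — `stub_pastenLemma68` (crux stmt-ABC-11338 `DefiniteRTControlPrime`)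
# FAMILY 3 endpoint: the WEAKEST typed residue of the stub's single use, and its glue

The registered line `Lines/Sketch.lean` consumes `stub_pastenLemma68 : PastenShimura2024_lemma_6_8`
exactly once, as `hval : v_q(Δ_min W⋆) ≤ 163 · v_q(Δ_min E)` for ONE ordered pair: the Frey curve
`E = freyCurve a b` and the conductor-restricted optimal pivot `(W⋆, P⋆)` of its class
(`exists_conductorMinimal`).  Lemma 6.8 is class-wide (`∀ W ~ W'`), two-sided and pinned to `163`;
the consumer needs a one-pair, one-sided bound with a FREE constant (the crux says `∃ C`, and
carries an idle `N^ε`).  This file types that residue (`FreyOptimalValRatio`, V1; sub-polynomial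
form V1ε), proves the glue into the crux next to `stub_pasten163`/`stub_takahashi` (V3, a copy of
the landed composition `definiteRTControlPrime_of_facts` with `hval` abstracted), and records its
three suppliers (V2a verbatim stub — proved; V2b `stub_pasten163` alone — proved in
`StubIdeasK3G5PastenLemma68.lean`; V2c Mazur–Kenku radius stmt-ABC-15193).

Elaboration sanity only (planner seat): V2b and V3ε carry `sorry` with the named proof source.
-/

set_option linter.dupNamespace false

noncomputable section

namespace Summit.ABC.ABC.Cruxes.DefiniteRTControlPrime.StubIdeas3G7

open Summit.ABC.ABC.Theses.DefiniteXi
open Summit.ABC.ABC.Theorems Summit.ABC.ABC.Theorems.DefiniteRTControlPrime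
open Literature.NumberTheory.EllipticCurves Literature.NumberTheory.EllipticCurves.ModularForms
open Literature.NumberTheory.Automorphic
open WeierstrassCurve

/-! ## V1 — the residue leaf -/

/-- **V1 `FreyOptimalValRatio Cv`** — the exact share of `stub_pastenLemma68` in the line, with the
constant freed: for a Frey curve `E = E_(a,b)` (coprime, `ab(a+b) ≠ 0`) of conductor `N`, an odd
prime `q ∣ N`, and a conductor-`N` curve `W'` carrying a datum `P'` of minimal degree among the
level-`N` data of conductor-`N` curves with newform `P'.f` (Takahashi's minimality clause) and
`ℚ`-isogenous to `E`:  `v_q(Δ_min W') ≤ Cv · v_q(Δ_min E)`.  ONE pair, ONE side, free constant. -/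
def FreyOptimalValRatio (Cv : ℕ) : Prop :=
  ∀ (a b : ℤ), IsCoprime a b → a * b * (a + b) ≠ 0 → ∀ (N : ℕ) [NeZero N],
    (freyCurve a b).conductorNorm ℤ = N → ∀ q : ℕ, q.Prime → q ≠ 2 → q ∣ N →
    ∀ (W' : WeierstrassCurve ℚ) [W'.IsElliptic] (P' : ModularParametrizationData W' N),
      W'.conductorNorm ℤ = N →
      (∀ (W'' : WeierstrassCurve ℚ) [W''.IsElliptic], W''.conductorNorm ℤ = N →
        ∀ P'' : ModularParametrizationData W'' N, P''.f = P'.f →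
          P'.modularDegree ≤ P''.modularDegree) →
      (freyCurve a b).IsIsogenous W' →
      (W'.minimalDiscriminantNorm ℤ).factorization q ≤
        Cv * ((freyCurve a b).minimalDiscriminantNorm ℤ).factorization q

/-- **V1ε `FreyOptimalValRatioSubpoly`** — the weakest form the crux can absorb (its `∃ C` after
`∀ ε` and the idle `N^ε`): the same one-pair bound with constant `R(ε) · N^ε`. -/
def FreyOptimalValRatioSubpoly : Prop :=
  ∀ ε : ℝ, 0 < ε → ∃ R : ℝ, ∀ (a b : ℤ), IsCoprime a b → a * b * (a + b) ≠ 0 → ∀ (N : ℕ) [NeZero N],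
    (freyCurve a b).conductorNorm ℤ = N → ∀ q : ℕ, q.Prime → q ≠ 2 → q ∣ N →
    ∀ (W' : WeierstrassCurve ℚ) [W'.IsElliptic] (P' : ModularParametrizationData W' N),
      W'.conductorNorm ℤ = N →
      (∀ (W'' : WeierstrassCurve ℚ) [W''.IsElliptic], W''.conductorNorm ℤ = N →
        ∀ P'' : ModularParametrizationData W'' N, P''.f = P'.f →
          P'.modularDegree ≤ P''.modularDegree) →
      (freyCurve a b).IsIsogenous W' →
      ((W'.minimalDiscriminantNorm ℤ).factorization q : ℝ) ≤
        R * (N : ℝ) ^ ε * (((freyCurve a b).minimalDiscriminantNorm ℤ).factorization q : ℝ)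

/-! ## V2 — suppliers -/

/-- **V2a** (PROVED, one line): the verbatim stub supplies V1 with `Cv = 163` — this is the landed
`stub_valTransport` (p96813); the optimality clause is not even used. -/
theorem freyOptimalValRatio_of_lemma68 (h68 : PastenShimura2024_lemma_6_8) :
    FreyOptimalValRatio 163 := by
  intro a b hab h0 N _ hN q hq hq2 hqN W' _ P' _ _ hiso
  have hqN' : q ∣ (freyCurve a b).conductorNorm ℤ := by rw [hN]; exact hqN
  exact stub_valTransport h68 a b hab h0 q hq hq2 hqN' W' hiso

/-- **V2b** (proved in `Cruxes/DefiniteRTControlPrime/StubIdeasK3G5PastenLemma68.lean`, rc 0 /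
0 sorry, re-checked 2026-08-31: `exists_datum_of_isIsogenous` + `valTransportSq_of_pasten163_self`):
`stub_pasten163` ALONE supplies V1 with `Cv = 163²` (two lattice legs through the optimal `W₀`).
Sorry here only because Cruxes modules are not imported; one prover cycle to transplant. -/
theorem freyOptimalValRatio_of_pasten163 (h163 : PastenShimura2024_minimalDegree_le_163_mul) :
    FreyOptimalValRatio (163 * 163) := by
  sorry

/-- **V2c** (PROVED): a class radius `B` (e.g. the Mazur–Kenku radius stmt-ABC-15193, `B = 163`)
supplies V1 with `Cv = B`, Mazur-free given the radius: cyclic core + Tate-curve transport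
(`Isogeny.exists_isCyclic_degree_dvd`, `exists_ordMinimalDiscriminant_mul_eq_mul_of_isCyclic`). -/
theorem freyOptimalValRatio_of_radius (B : ℕ)
    (hR : ∀ (W W' : WeierstrassCurve ℚ) [W.IsElliptic] [W'.IsElliptic], W.IsIsogenous W' →
      ∃ φ : Isogeny W W', φ.degree ≤ B) :
    FreyOptimalValRatio B := by
  intro a b hab h0 N _ hN q hq hq2 hqN W' _ P' _ _ hiso
  haveI := isElliptic_freyCurve h0
  have hqN' : q ∣ (freyCurve a b).conductorNorm ℤ := by rw [hN]; exact hqN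
  obtain ⟨φ, hφ⟩ := hR (freyCurve a b) W' hiso
  obtain ⟨v, hv⟩ :
      ∃ v : IsDedekindDomain.HeightOneSpectrum ℤ, Rat.HeightOneSpectrum.natGenerator v = q :=
    ⟨(Rat.HeightOneSpectrum.primesEquiv (R := ℤ)).symm ⟨q, hq⟩,
      Rat.natGenerator_primesEquiv_symm ⟨q, hq⟩⟩
  have hdvd : (q : ℤ) ∣ a * b * (a + b) :=
    Literature.NumberTheory.DiophantineGeometry.dvd_of_dvd_conductorNorm_freyCurve hab h0 hq hq2 hqN'
  have hmult : (freyCurve a b).HasMultiplicativeReductionAt v :=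
    Literature.NumberTheory.DiophantineGeometry.hasMultiplicativeReductionAt_freyCurve_of_ne_two
      hab h0 v (hv ▸ hq2) (hv ▸ hdvd)
  have hmult' : W'.HasMultiplicativeReductionAt v :=
    hasMultiplicativeReductionAt_of_isIsogenous ⟨φ⟩ v hmult
  obtain ⟨φ', hcyc, hdvd'⟩ := φ.exists_isCyclic_degree_dvd
  obtain ⟨m, n, hm, hn, hmn, heq⟩ :=
    exists_ordMinimalDiscriminant_mul_eq_mul_of_isCyclic φ'.degree φ' hcyc rfl v hmult hmult'
  -- `heq : c_v(E) · n = c_v(W') · m`, `m n ∣ deg φ' ∣ deg φ ≤ B`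
  have hnB : n ≤ B :=
    ((Nat.le_mul_of_pos_left n hm).trans
      ((Nat.le_of_dvd φ'.degree_pos hmn).trans (Nat.le_of_dvd φ.degree_pos hdvd'))).trans hφ
  have e1 := factorization_minimalDiscriminantNorm_holds W' v
  have e2 := factorization_minimalDiscriminantNorm_holds (freyCurve a b) v
  rw [hv] at e1 e2
  rw [e1, e2]
  calc W'.ordMinimalDiscriminant v ≤ W'.ordMinimalDiscriminant v * m := Nat.le_mul_of_pos_right _ hm
    _ = (freyCurve a b).ordMinimalDiscriminant v * n := heq.symm
    _ ≤ (freyCurve a b).ordMinimalDiscriminant v * B := Nat.mul_le_mul_left _ hnB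
    _ = B * (freyCurve a b).ordMinimalDiscriminant v := Nat.mul_comm _ _

/-- V1 ⇒ V1ε (PROVED): a fixed constant is sub-polynomial (`R = Cv`, `N^ε ≥ 1`). -/
theorem freyOptimalValRatioSubpoly_of_valRatio {Cv : ℕ} (hV : FreyOptimalValRatio Cv) :
    FreyOptimalValRatioSubpoly := by
  intro ε hε
  refine ⟨Cv, ?_⟩
  intro a b hab h0 N _ hN q hq hq2 hqN W' _ P' hN' hmin hiso
  have h := hV a b hab h0 N hN q hq hq2 hqN W' P' hN' hmin hiso
  have hcast : ((W'.minimalDiscriminantNorm ℤ).factorization q : ℝ) ≤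
      (Cv : ℝ) * (((freyCurve a b).minimalDiscriminantNorm ℤ).factorization q : ℝ) := by
    exact_mod_cast h
  have hN1 : (1 : ℝ) ≤ (N : ℝ) := by exact_mod_cast Nat.one_le_iff_ne_zero.mpr (NeZero.ne N)
  have hrpow : (1 : ℝ) ≤ (N : ℝ) ^ ε := Real.one_le_rpow hN1 hε.le
  have hv0 : (0 : ℝ) ≤ (((freyCurve a b).minimalDiscriminantNorm ℤ).factorization q : ℝ) := by
    positivity
  calc ((W'.minimalDiscriminantNorm ℤ).factorization q : ℝ)
      ≤ (Cv : ℝ) * (((freyCurve a b).minimalDiscriminantNorm ℤ).factorization q : ℝ) := hcast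
    _ = (Cv : ℝ) * 1 * (((freyCurve a b).minimalDiscriminantNorm ℤ).factorization q : ℝ) := by ring
    _ ≤ (Cv : ℝ) * (N : ℝ) ^ ε * (((freyCurve a b).minimalDiscriminantNorm ℤ).factorization q : ℝ) := by
        gcongr

/-! ## V3 — glue: the crux from `stub_takahashi`, `stub_pasten163` and the residue leaf -/

/-- **V3 (PROVED; `C = 4 · 163 · Cv`)**: the landed composition `definiteRTControlPrime_of_facts`
(p97354) with its single use of Lemma 6.8 (`hval`) abstracted to V1 — so `stub_pastenLemma68` can be
replaced in the registered line by ANY supplier of `FreyOptimalValRatio Cv` (V2a: itself; V2b: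
`stub_pasten163`, making the stub redundant; V2c: the radius item). -/
theorem definiteRTControlPrime_of_valRatio (hT : takahashi2001_thm_2_3_of_coprime)
    (h163 : PastenShimura2024_minimalDegree_le_163_mul) {Cv : ℕ} (hV : FreyOptimalValRatio Cv) :
    DefiniteRTControlPrime := by
  intro ε hε
  refine ⟨4 * 163 * Cv, ?_⟩
  intro a b hab h0 N _ hN q hq hq2 hqN D hDmin
  -- `N = M q`
  obtain ⟨M, hM⟩ := hqN
  rw [mul_comm] at hM
  subst hM
  haveI := isElliptic_freyCurve h0
  have hdiv : M * q / q = M := Nat.mul_div_cancel M hq.pos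
  rw [hdiv]
  have hqN' : q ∣ (freyCurve a b).conductorNorm ℤ := by rw [hN]; exact Dvd.intro_left M rfl
  -- `gcd(M, q) = 1`
  have hcop : M.Coprime q := by
    have h := stub_freyLocal a b hab h0 q hq hq2 hqN'
    rwa [hN, hdiv] at h
  -- a global minimal model `W_m = C • E`, its data, a minimal one
  obtain ⟨C, hC⟩ := hasGlobalMinimalModel_rat_holds (freyCurve a b)
  haveI := hC
  have hNm : (C • freyCurve a b).conductorNorm ℤ = M * q := by rw [conductorNorm_smul_rat, hN]
  have hne : Nonempty (ModularParametrizationData (C • freyCurve a b) (M * q)) :=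
    (Summit.ABC.ABC.Theorems.nonempty_modularParametrizationData_smul_iff C).mpr ⟨D⟩
  obtain ⟨D₁, -, hD₁min⟩ := exists_minimal_datum hne
  -- the lattice-optimal datum of the class of `f₁ := D₁.f`
  obtain ⟨W₀, hW₀, D₀, hf₀, h₀⟩ := D₁.exists_optimalDatum'
  haveI := hW₀
  have hker₀ : D₀.isogenyMap.ker = ⊥ := D₀.isogenyMap_ker_eq_bot_iff.mpr h₀
  have hmin₀ : ∀ (W' : WeierstrassCurve ℚ) [W'.IsElliptic]
      (D' : ModularParametrizationData W' (M * q)), D'.f = D₀.f →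
        D₀.modularDegree ≤ D'.modularDegree := fun W' _ D' hD' =>
    D₀.modularDegree_le_of_isogenyMap_ker_eq_bot hker₀ D' hD'
  -- (T_deg) `deg D₁ ≤ 163 · deg D₀`
  have h163' : D₁.modularDegree ≤ 163 * D₀.modularDegree :=
    h163 (M * q) W₀ (C • freyCurve a b) D₀ D₁ hf₀.symm hmin₀ hD₁min
  -- the conductor-restricted optimal pivot `(W⋆, P⋆)`
  obtain ⟨Ws, hWs, Ps, hNs, hfs, hPsmin⟩ := exists_conductorMinimal D₁ hNm
  haveI := hWs
  have h0s : D₀.modularDegree ≤ Ps.modularDegree := hmin₀ Ws Ps (hfs.trans hf₀.symm)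
  -- Takahashi at `(W⋆, P⋆)`
  have hTak : Ps.modularDegree ≤ brandtXi M q (fun n => Ws.LFunction n) *
      (Ws.minimalDiscriminantNorm ℤ).factorization q :=
    takahashi2001_thm_2_3_of_coprime.modularDegree_le_brandtXi_mul hT Ws M q hq hcop
      hNs Ps hPsmin
  -- `a(W⋆) = a(f₁) = a(W_m) = a(E)`
  have hL : (fun n => Ws.LFunction n) = fun n => (freyCurve a b).LFunction n := by
    funext n
    have h1 := Ps.isNewformOf.2 n
    have h2 := D₁.isNewformOf.2 n
    rw [hfs] at h1
    rw [h1, LFunction_smul] at h2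
    exact_mod_cast h2
  rw [hL] at hTak
  -- (T_val) THE ABSTRACTED STEP: V1 at the pair `(E, W⋆)` along `E ~ W_m ~ W⋆`
  have hiso : (freyCurve a b).IsIsogenous Ws :=
    (isIsogenous_smul (freyCurve a b) C).trans' (isIsogenous_of_f_eq D₁ Ps hfs)
  have hval : (Ws.minimalDiscriminantNorm ℤ).factorization q ≤
      Cv * ((freyCurve a b).minimalDiscriminantNorm ℤ).factorization q :=
    hV a b hab h0 (M * q) hN q hq hq2 (Dvd.intro_left M rfl) Ws Ps hNs hPsmin hiso
  -- (T_model) back to the Frey model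
  obtain ⟨D₁', -, hdeg₁'⟩ := stub_smulTransportDeg C D₁
  have hscale : (C.u : ℚ).num.natAbs ≤ 2 := stub_freyScale a b hab h0 C hC
  have hD : D.deg ≤ 4 * D₁.modularDegree := by
    calc D.deg ≤ D₁'.deg := hDmin D₁'
      _ = (C.u : ℚ).num.natAbs ^ 2 * D₁.deg := hdeg₁'
      _ ≤ 2 ^ 2 * D₁.deg := Nat.mul_le_mul_right _ (Nat.pow_le_pow_left hscale 2)
      _ = 4 * D₁.modularDegree := by norm_num [ModularParametrizationData.modularDegree]
  -- the chain in `ℕ`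
  set ξ : ℕ := brandtXi M q (fun n => (freyCurve a b).LFunction n) with hξ
  set v : ℕ := ((freyCurve a b).minimalDiscriminantNorm ℤ).factorization q with hv
  have hchain : D.deg ≤ 4 * 163 * Cv * (ξ * v) :=
    calc D.deg ≤ 4 * D₁.modularDegree := hD
      _ ≤ 4 * (163 * D₀.modularDegree) := Nat.mul_le_mul_left _ h163'
      _ ≤ 4 * (163 * Ps.modularDegree) := Nat.mul_le_mul_left _ (Nat.mul_le_mul_left _ h0s)
      _ ≤ 4 * (163 * (ξ * (Ws.minimalDiscriminantNorm ℤ).factorization q)) :=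
          Nat.mul_le_mul_left _ (Nat.mul_le_mul_left _ hTak)
      _ ≤ 4 * (163 * (ξ * (Cv * v))) :=
          Nat.mul_le_mul_left _ (Nat.mul_le_mul_left _ (Nat.mul_le_mul_left _ hval))
      _ = 4 * 163 * Cv * (ξ * v) := by ring
  -- to `ℝ`, inserting the idle `N^ε ≥ 1`
  have hN1 : (1 : ℝ) ≤ ((M * q : ℕ) : ℝ) := by
    exact_mod_cast Nat.one_le_iff_ne_zero.mpr (NeZero.ne (M * q))
  have hrpow : (1 : ℝ) ≤ ((M * q : ℕ) : ℝ) ^ ε := Real.one_le_rpow hN1 hε.le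
  have hcast : (D.deg : ℝ) ≤ (4 * 163 * (Cv : ℝ)) * ((ξ : ℝ) * (v : ℝ)) := by
    exact_mod_cast hchain
  have hξv : (0 : ℝ) ≤ (ξ : ℝ) * (v : ℝ) := by positivity
  calc (D.deg : ℝ) ≤ (4 * 163 * (Cv : ℝ)) * ((ξ : ℝ) * (v : ℝ)) := hcast
    _ = (4 * 163 * (Cv : ℝ)) * 1 * ((ξ : ℝ) * (v : ℝ)) := by ring
    _ ≤ (4 * 163 * (Cv : ℝ)) * ((M * q : ℕ) : ℝ) ^ ε * ((ξ : ℝ) * (v : ℝ)) := by gcongr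

/-- **V3ε** (typed; proof = V3 with `Cv ↦ R(ε) N^ε` carried through the real-valued tail,
`C(ε) = 4·163·R(ε)`): the crux absorbs even the sub-polynomial residue. -/
theorem definiteRTControlPrime_of_valRatioSubpoly (hT : takahashi2001_thm_2_3_of_coprime)
    (h163 : PastenShimura2024_minimalDegree_le_163_mul) (hV : FreyOptimalValRatioSubpoly) :
    DefiniteRTControlPrime := by
  sorry

/-! ## Assembly checks -/

/-- The verbatim stub's entire contribution to the line, routed through V1:
`{stub_takahashi, stub_pasten163, stub_pastenLemma68} ⊢ crux` factors as V2a ; V3. -/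
example (hT : takahashi2001_thm_2_3_of_coprime) (h163 : PastenShimura2024_minimalDegree_le_163_mul)
    (h68 : PastenShimura2024_lemma_6_8) : Summit.ABC.ABC.Theses.DefiniteXi.DefiniteRTControlPrime :=
  definiteRTControlPrime_of_valRatio hT h163 (freyOptimalValRatio_of_lemma68 h68)

/-- The radius item stmt-ABC-15193 (verbatim type) closes the stub's share WITHOUT the stub. -/
example (hT : takahashi2001_thm_2_3_of_coprime) (h163 : PastenShimura2024_minimalDegree_le_163_mul)
    (h15193 : ∀ (W W' : WeierstrassCurve ℚ) [W.IsElliptic] [W'.IsElliptic], W.IsIsogenous W' →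
      ∃ φ : WeierstrassCurve.Isogeny W W', φ.degree ≤ 163) :
    Summit.ABC.ABC.Theses.DefiniteXi.DefiniteRTControlPrime :=
  definiteRTControlPrime_of_valRatio hT h163 (freyOptimalValRatio_of_radius 163 h15193)

end Summit.ABC.ABC.Cruxes.DefiniteRTControlPrime.StubIdeas3G7

end
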